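import Summits.Parity.BatemanHorn.Theorems.SoloInformedRootCountLevel
import Literature.NumberTheory.Sieve.FriedlanderIwaniecPrimesHyp27Unconditional

/-!
# The quadratic divisor sum `∑_{n ≤ x} τ(g(n)) = 2 A_g x log x + O(x)` in the kernel — and why degree 2 is the last easy case

Solo informed line (Parity / Bateman–Horn), session 136.  The divisor-pairing storey of
`SoloInformedDivisorPairingStorey` and the Dedekind–Landau mean value of `SoloInformedRootCountLevel` give,
for every irreducible `g ∈ ℤ[X]` of positive degree with `n² ≤ |g(n)|` on `[1, ∞)`,

  `∑_{n ≤ x} τ(|g(n)|) = 2 A_g · x log x + 2 · Mid_g(x) + O(x)`,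

where `Mid_g(x) = polyLocatedRootCount g x = #{(n, e) : n ≤ x, e ∣ g(n), x < e, e² < |g(n)|}` is the LOCATED
ROOT COUNT — roots of `g` modulo moduli `e` in the window `(x, |g(n)|^{1/2})`.

* **Degree 2** (this file).  If `|g(n)| ≤ (B n)²`, the window `(x, |g(n)|^{1/2})` has bounded multiplicative width:
  every located modulus satisfies `x < e ≤ B x`, and swapping the sums,
  `Mid_g(x) ≤ ∑_{x < e ≤ Bx} #{n ≤ x : e ∣ g(n)} ≤ ∑_{x < e ≤ Bx} (x ρ_g(e)/e + ρ_g(e)) ≤ 2 ∑_{e ≤ Bx} ρ_g(e) = O(x)`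
  by the Hall–Tenenbaum first moment (`exists_sum_rootCount_le`).  Hence
  `∑_{n ≤ x} τ(|g(n)|) = 2 A_g x log x + O(x)` (`exists_abs_polyDivisorSum_sub_log_le_of_quadratic_growth`), and in
  particular the classical `∑_{n ≤ x} τ(n² + 1) = 2 A x log x + O(x)` with `A = rootLevelConst (X² + 1)`
  (`exists_abs_divisorSum_sq_add_one_sub_log_le`), unconditionally and sorry-free.
* **Degree 3** (`SoloInformedRootCountLevel.exists_abs_polyDivisorSum_cubic_sub_log_le`).  For `g = X³ + 2` the
  window is `(x, n^{3/2})`, of multiplicative width `x^{1/2}`; the same swap gives only the trivial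
  `Mid_g(x) ≤ 2 ∑_{e ≤ B x^{3/2}} ρ_g(e) = O(x^{3/2})` (Erdős's 1952 bound `∑_{n ≤ x} τ(g(n)) ≪ x log x`, not in the
  tree, gives `Mid_g(x) ≪ x log x`, the order of the main term), and the asymptotic `∑_{n ≤ x} τ(n³ + 2) ∼ c x log x`
  is EQUIVALENT to an asymptotic for `Mid_g(x)` — roots of a cubic to moduli in `(x, x^{3/2})`, a
  level-of-distribution statement past `x` which no available method supplies (see the docstrings there).  The
  located root count is exactly where degree 3 parts from degree 2.

All statements are elementary consequences of tree theorems; no hypothesis beyond irreducibility and the two growth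
inequalities is used.
-/

open Finset Real Polynomial

namespace Summit.Parity.BatemanHorn.Theorems

open Literature.NumberTheory.Sieve (polyRootCountMod exists_sum_rootCount_le)

/-- **Swap bound for the located root count.**  If `|g(n)| ≤ (B n)²` for `1 ≤ n ≤ x`, then every located pair
`(n, e)` has `x < e ≤ B x`, and `Mid_g(x) ≤ ∑_{x < e ≤ Bx} #{1 ≤ n ≤ x : e ∣ g(n)}`. -/
theorem polyLocatedRootCount_le_sum_card (g : ℤ[X]) {B x : ℕ}
    (hgr : ∀ n ∈ Icc 1 x, (g.eval (n : ℤ)).natAbs ≤ (B * n) * (B * n)) :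
    polyLocatedRootCount g x
      ≤ ∑ e ∈ Icc (x + 1) (B * x), #((Icc 1 x).filter fun n : ℕ => (e : ℤ) ∣ g.eval (n : ℤ)) := by
  unfold polyLocatedRootCount
  have h1 : ∀ n ∈ Icc 1 x,
      #(((g.eval (n : ℤ)).natAbs.divisors).filter fun e => x < e ∧ e * e < (g.eval (n : ℤ)).natAbs)
        ≤ ∑ e ∈ Icc (x + 1) (B * x), if ((e : ℤ) ∣ g.eval (n : ℤ)) then 1 else 0 := by
    intro n hn
    rw [← card_filter]
    refine card_le_card_of_injOn (fun e => e) (fun e he => ?_) (Set.injOn_id _)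
    simp only [coe_filter, Nat.mem_divisors, mem_Icc, Set.mem_setOf_eq] at he ⊢
    obtain ⟨⟨heN, _⟩, hxe, hee⟩ := he
    have hnx : n ≤ x := (mem_Icc.mp hn).2
    have hlt : e * e < (B * x) * (B * x) :=
      lt_of_lt_of_le (lt_of_lt_of_le hee (hgr n hn))
        (Nat.mul_le_mul (Nat.mul_le_mul_left _ hnx) (Nat.mul_le_mul_left _ hnx))
    exact ⟨⟨by omega, (Nat.mul_self_lt_mul_self_iff.mp hlt).le⟩, Int.natCast_dvd.mpr heN⟩
  refine (sum_le_sum h1).trans ?_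
  rw [sum_comm]
  refine sum_le_sum fun e _ => ?_
  rw [← card_filter]

/-- **The located root count is `≤ 2 ∑_{e ≤ Bx} ρ_g(e)`** under `|g(n)| ≤ (B n)²` on `[1, x]`: each class count
`#{n ≤ x : e ∣ g(n)}` with `e > x` is at most `x ρ_g(e)/e + ρ_g(e) ≤ 2 ρ_g(e)`. -/
theorem polyLocatedRootCount_le_two_mul_sum (g : ℤ[X]) {B x : ℕ}
    (hgr : ∀ n ∈ Icc 1 x, (g.eval (n : ℤ)).natAbs ≤ (B * n) * (B * n)) :
    (polyLocatedRootCount g x : ℝ) ≤ 2 * ∑ e ∈ Icc 1 (B * x), (polyRootCountMod ![g] e : ℝ) := by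
  have hstep := polyLocatedRootCount_le_sum_card g hgr
  calc (polyLocatedRootCount g x : ℝ)
      ≤ ∑ e ∈ Icc (x + 1) (B * x), (#((Icc 1 x).filter fun n : ℕ => (e : ℤ) ∣ g.eval (n : ℤ)) : ℝ) := by
        exact_mod_cast hstep
    _ ≤ ∑ e ∈ Icc (x + 1) (B * x), 2 * (polyRootCountMod ![g] e : ℝ) := by
        refine sum_le_sum fun e he => ?_
        have hxe : x + 1 ≤ e := (mem_Icc.mp he).1
        have he0 : 0 < e := by omega
        have h := abs_card_filter_dvd_eval_sub_le g he0 x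
        have hρ : (0 : ℝ) ≤ polyRootCountMod ![g] e := Nat.cast_nonneg _
        have hq : (x : ℝ) / e ≤ 1 := by
          rw [div_le_one (by exact_mod_cast he0)]
          exact_mod_cast (by omega : x ≤ e)
        have hle : (x : ℝ) * (polyRootCountMod ![g] e : ℝ) / e ≤ polyRootCountMod ![g] e := by
          calc (x : ℝ) * (polyRootCountMod ![g] e : ℝ) / e
              = (polyRootCountMod ![g] e : ℝ) * ((x : ℝ) / e) := by ring
            _ ≤ (polyRootCountMod ![g] e : ℝ) * 1 := mul_le_mul_of_nonneg_left hq hρ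
            _ = polyRootCountMod ![g] e := mul_one _
        have := (abs_sub_le_iff.mp h).1
        linarith
    _ ≤ ∑ e ∈ Icc 1 (B * x), 2 * (polyRootCountMod ![g] e : ℝ) := by
        refine sum_le_sum_of_subset_of_nonneg (Icc_subset_Icc (by omega) le_rfl) ?_
        intro e _ _
        positivity
    _ = 2 * ∑ e ∈ Icc 1 (B * x), (polyRootCountMod ![g] e : ℝ) := by rw [mul_sum]

/-- **`Mid_g(x) = O(x)` for polynomials of quadratic growth**: if `g` is irreducible of positive degree and
`|g(n)| ≤ (B n)²` for all `n ≥ 1` (`B ≥ 1`), then `Mid_g(x) ≤ 2 C_g B · x` for `x ≥ 2`, by the Hall–Tenenbaum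
first moment `∑_{e ≤ y} ρ_g(e) ≤ C_g y`. -/
theorem exists_polyLocatedRootCount_le {g : ℤ[X]} (hirr : Irreducible g) (hdeg : 0 < g.natDegree)
    {B : ℕ} (hB : 1 ≤ B) (hgr : ∀ n : ℕ, 1 ≤ n → (g.eval (n : ℤ)).natAbs ≤ (B * n) * (B * n)) :
    ∃ C : ℝ, ∀ x : ℕ, 2 ≤ x → (polyLocatedRootCount g x : ℝ) ≤ C * x := by
  obtain ⟨C, _, hC⟩ := exists_sum_rootCount_le hirr hdeg
  refine ⟨2 * C * B, fun x hx => ?_⟩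
  have h1 := polyLocatedRootCount_le_two_mul_sum g (B := B) (x := x)
    (fun n hn => hgr n (mem_Icc.mp hn).1)
  have hBx : 2 ≤ B * x := by nlinarith
  have hy : (2 : ℝ) ≤ ((B * x : ℕ) : ℝ) := by exact_mod_cast hBx
  have h2 := hC ((B * x : ℕ) : ℝ) hy
  rw [Nat.floor_natCast] at h2
  calc (polyLocatedRootCount g x : ℝ)
      ≤ 2 * ∑ e ∈ Icc 1 (B * x), (polyRootCountMod ![g] e : ℝ) := h1
    _ ≤ 2 * (C * ((B * x : ℕ) : ℝ)) := by linarith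
    _ = 2 * C * B * x := by push_cast; ring

/-- **The divisor sum of a polynomial of quadratic growth**: for `g` irreducible of positive degree with
`n² ≤ |g(n)| ≤ (B n)²` for all `n ≥ 1`,
`|∑_{n ≤ x} τ(|g(n)|) − 2 A_g x log x| ≤ C x` for `x ≥ 2`, `A_g = rootLevelConst g`.  (The two growth
inequalities force `deg g = 2`.) -/
theorem exists_abs_polyDivisorSum_sub_log_le_of_quadratic_growth {g : ℤ[X]}
    (hirr : Irreducible g) (hdeg : 0 < g.natDegree) {B : ℕ} (hB : 1 ≤ B)
    (hsq : ∀ n : ℕ, 1 ≤ n → n * n ≤ (g.eval (n : ℤ)).natAbs)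
    (hgr : ∀ n : ℕ, 1 ≤ n → (g.eval (n : ℤ)).natAbs ≤ (B * n) * (B * n)) :
    ∃ C : ℝ, ∀ x : ℕ, 2 ≤ x →
      |(polyDivisorSum g x : ℝ) - 2 * rootLevelConst g * (x : ℝ) * Real.log x| ≤ C * x := by
  obtain ⟨C₁, hC₁⟩ := exists_abs_polyDivisorSum_sub_located_sub_log_le_uncond hirr hdeg hsq
  obtain ⟨C₂, hC₂⟩ := exists_polyLocatedRootCount_le hirr hdeg hB hgr
  refine ⟨C₁ + 2 * C₂, fun x hx => ?_⟩
  have h1 := hC₁ x hx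
  have h2 := hC₂ x hx
  have h0 : (0 : ℝ) ≤ polyLocatedRootCount g x := Nat.cast_nonneg _
  rw [abs_le] at h1 ⊢
  constructor <;> nlinarith [h1.1, h1.2]

/-! ## The instance `n² + 1` -/

/-- `(X² + 1)(n) = n² + 1` as a natural number. -/
theorem natAbs_eval_X_sq_add_one (n : ℕ) :
    ((X ^ 2 + 1 : ℤ[X]).eval (n : ℤ)).natAbs = n ^ 2 + 1 := by
  have h : ((X ^ 2 + 1 : ℤ[X]).eval (n : ℤ)) = (n : ℤ) ^ 2 + 1 := by simp
  rw [h, show ((n : ℤ) ^ 2 + 1 : ℤ) = ((n ^ 2 + 1 : ℕ) : ℤ) by push_cast; ring, Int.natAbs_natCast]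

/-- `|n² + 1| ≤ (2n)²` for `n ≥ 1`. -/
theorem natAbs_eval_X_sq_add_one_le (n : ℕ) (hn : 1 ≤ n) :
    ((X ^ 2 + 1 : ℤ[X]).eval (n : ℤ)).natAbs ≤ (2 * n) * (2 * n) := by
  rw [natAbs_eval_X_sq_add_one]
  nlinarith

/-- `polyDivisorSum (X² + 1) x = ∑_{n ≤ x} τ(n² + 1)`. -/
theorem polyDivisorSum_X_sq_add_one (x : ℕ) :
    polyDivisorSum (X ^ 2 + 1) x = ∑ n ∈ Icc 1 x, #((n ^ 2 + 1).divisors) := by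
  unfold polyDivisorSum
  exact sum_congr rfl fun n _ => by rw [natAbs_eval_X_sq_add_one]

/-- **`Mid(x) = O(x)` for `n² + 1`**: the located root count of `X² + 1` — roots of `n² + 1` to moduli
`e ∈ (x, (n²+1)^{1/2})`, i.e. essentially `e ∈ (x, n]`, an EMPTY window up to the boundary — is `O(x)`. -/
theorem exists_polyLocatedRootCount_X_sq_add_one_le :
    ∃ C : ℝ, ∀ x : ℕ, 2 ≤ x → (polyLocatedRootCount (X ^ 2 + 1) x : ℝ) ≤ C * x :=
  exists_polyLocatedRootCount_le
    Literature.NumberTheory.Sieve.FriedlanderIwaniecPrimes.irreducible_X_sq_add_one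
    (by rw [show (X ^ 2 + 1 : ℤ[X]) = X ^ 2 + C 1 by simp, natDegree_X_pow_add_C]; norm_num)
    (B := 2) (by norm_num) natAbs_eval_X_sq_add_one_le

/-- **The classical quadratic divisor sum, sorry-free**: there is `C` with
`|∑_{n ≤ x} τ(n² + 1) − 2 A · x log x| ≤ C x` for all `x ≥ 2`, where `A = rootLevelConst (X² + 1)` is the
Dedekind–Landau constant of `SoloInformedRootCountLevel` (`∑_{d ≤ x} ρ(d)/d = A log x + O(1)`, `ρ(d)` the
number of roots of `n² + 1 ≡ 0 (mod d)`).  Contrast `SoloInformedRootCountLevel.exists_abs_polyDivisorSum_cubic_sub_log_le`: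
for `n³ + 2` the same machinery leaves `2·Mid(x)`, of the order of the main term, undetermined. [this work] -/
theorem exists_abs_divisorSum_sq_add_one_sub_log_le :
    ∃ C : ℝ, ∀ x : ℕ, 2 ≤ x →
      |((∑ n ∈ Icc 1 x, #((n ^ 2 + 1).divisors) : ℕ) : ℝ)
          - 2 * rootLevelConst (X ^ 2 + 1) * (x : ℝ) * Real.log x| ≤ C * x := by
  obtain ⟨C, hC⟩ := exists_abs_polyDivisorSum_sub_log_le_of_quadratic_growth
    Literature.NumberTheory.Sieve.FriedlanderIwaniecPrimes.irreducible_X_sq_add_one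
    (by rw [show (X ^ 2 + 1 : ℤ[X]) = X ^ 2 + C 1 by simp, natDegree_X_pow_add_C]; norm_num)
    (B := 2) (by norm_num) (fun n _ => sq_le_natAbs_eval_quadratic n) natAbs_eval_X_sq_add_one_le
  refine ⟨C, fun x hx => ?_⟩
  rw [← polyDivisorSum_X_sq_add_one]
  exact hC x hx

end Summit.Parity.BatemanHorn.Theorems
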